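import Literature.Topology.FourManifolds.FishtailTubeRef
import Literature.Topology.FourManifolds.FishtailMTorusInvariants
import HarnessLib

/-!
# The reference disc: zero-offset forms of the reference tube

Infrastructure for the explicit fishtail neighbourhood (R. Gompf, *More Cappell–Shaneson spheres
are standard*, Algebr. Geom. Topol. 10 (2010), proof of Thm 2.1 and Lemma 2.2; the named fact
`Literature.Topology.FourManifolds.gompf2010_framedTwist`). The reference disc
`D(ζ) = tubeD_ref (ζ, 0, 0)` (Gompf's disc `D` itself, read through the reference tube of
`FishtailTubeRef.lean`) window by window at zero offset:

* over `D⁰` (south chart, flat annulus, north chart) it is an old point `[x, s]` off the surgery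
  circle with invariants `(latC, yC, baseC) = (e^{in}, 1, e^{iϑ})` (south/annulus, latitude
  `n = nfun ‖ζ‖`) resp. `(e^{i capN d}, 1, e^{i arg d})` (north, `d = tdisc (P e^{iϑ})`), or one
  of the two new points (the centres of the two cap charts);
* over the upper pieces U5…U1 it is `toSurg (mtCoord ((N - ϑ, Y, ϑ), S))` with explicit
  `(N, Y, S)`.

Everything is proved; no named facts.

## References

* R. E. Gompf, *More Cappell–Shaneson spheres are standard*, Algebr. Geom. Topol. 10 (2010)
  1665–1681, proof of Thm 2.1 and Lemma 2.2. [GompfAGT2010]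
-/

noncomputable section

open scoped Real Topology ContDiff Manifold
open Set Filter Complex

namespace Literature.Topology.FourManifolds

local notation "𝔼 " n:arg => EuclideanSpace ℝ (Fin n)

/-! ### The base angle of a two-chart point -/

/-- `e^{2πi baseOf u} = e^{i arg u}` for `u ≠ 0` (both are `u/|u|`). [folklore] -/
theorem circleExp_two_pi_baseOf {u : ℂ} (hu : u ≠ 0) : Circle.exp (2 * π * baseOf u) = Circle.exp (arg u) := by
  have hπ := Real.pi_pos
  rcases lt_or_ge u.re 0 with h | h
  · rw [baseOf_of_neg h, show 2 * π * (arg (-u) / (2 * π) + 1 / 2) = arg (-u) + π by field_simp]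
    apply Subtype.ext
    rw [Circle.coe_exp, Circle.coe_exp]
    have h1 := norm_mul_exp_arg_mul_I (-u)
    have h2 := norm_mul_exp_arg_mul_I u
    rw [norm_neg] at h1
    have hn : (‖u‖ : ℂ) ≠ 0 := by exact_mod_cast (norm_ne_zero_iff.2 hu)
    apply mul_left_cancel₀ hn
    rw [h2, show ((arg (-u) + π : ℝ) : ℂ) * I = arg (-u) * I + π * I by push_cast; ring, Complex.exp_add, exp_pi_mul_I,
      show (‖u‖ : ℂ) * (exp (arg (-u) * I) * -1) = -((‖u‖ : ℂ) * exp (arg (-u) * I)) by ring, h1, neg_neg]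
  · rw [baseOf_of_nonneg h, show 2 * π * (arg u / (2 * π) + 1) = arg u + 2 * π by field_simp, Circle.exp_add,
      Circle.exp_two_pi, mul_one]

/-- `e^{i arg z} = z / |z|`; for `z = e^{iϑ}`: `Circle.exp (arg z) = Circle.exp ϑ`. [folklore] -/
theorem circleExp_arg_exp (ϑ : ℝ) : Circle.exp (arg (exp (ϑ * I))) = Circle.exp ϑ := by
  apply Subtype.ext
  rw [Circle.coe_exp, Circle.coe_exp]
  have h := norm_mul_exp_arg_mul_I (exp (ϑ * I))
  rwa [Complex.norm_exp_ofReal_mul_I, Complex.ofReal_one, one_mul] at h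

/-- For `u = e^{iϑ}`: `e^{2πi baseOf u} = e^{iϑ}`. [folklore] -/
theorem circleExp_two_pi_baseOf_exp (ϑ : ℝ) : Circle.exp (2 * π * baseOf (exp (ϑ * I))) = Circle.exp ϑ := by
  rw [circleExp_two_pi_baseOf (Complex.exp_ne_zero _), circleExp_arg_exp]

/-- The invariants of a two-chart point `mtCoord (v, baseOf e^{iϑ})`: latitude `e^{i(v₀+v₂)}`,
fibre `e^{iv₁}`, base `e^{iϑ}`. [folklore] -/
theorem invariants_mtCoord_baseOf (v : 𝔼 3) (ϑ : ℝ) :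
    latC (mtCoord tubeShearDiffeo (v, baseOf (exp (ϑ * I)))) = Circle.exp (v 0 + v 2) ∧
      yC (mtCoord tubeShearDiffeo (v, baseOf (exp (ϑ * I)))) = Circle.exp (v 1) ∧
      baseC (mtCoord tubeShearDiffeo (v, baseOf (exp (ϑ * I)))) = Circle.exp ϑ := by
  have hb := baseOf_mem' (exp (ϑ * I))
  exact ⟨latC_mtCoord hb.1 hb.2, yC_mtCoord hb.1 hb.2, by rw [baseC_mtCoord hb.1 hb.2]; exact circleExp_two_pi_baseOf_exp ϑ⟩

/-- The invariants of `[(e^{in} f⁻¹, z₂, f), baseOf e^{iϑ}]`. [folklore] -/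
theorem invariants_mtPt_baseOf (n : ℝ) (z₂ f : Circle) (ϑ : ℝ) :
    latC (mtPt tubeShearDiffeo (Circle.exp n * f⁻¹, z₂, f) (baseOf (exp (ϑ * I)))) = Circle.exp n ∧
      yC (mtPt tubeShearDiffeo (Circle.exp n * f⁻¹, z₂, f) (baseOf (exp (ϑ * I)))) = z₂ ∧
      baseC (mtPt tubeShearDiffeo (Circle.exp n * f⁻¹, z₂, f) (baseOf (exp (ϑ * I)))) = Circle.exp ϑ := by
  have hb := baseOf_mem' (exp (ϑ * I))
  refine ⟨?_, yC_mtPt _ hb.1 hb.2, by rw [baseC_mtPt _ hb.1 hb.2]; exact circleExp_two_pi_baseOf_exp ϑ⟩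
  rw [latC_mtPt _ hb.1 hb.2]; simp

namespace FP

variable {ε : ℝ} (hε : 0 < ε) (hε2 : ε ≤ 1 / 2)

/-- **The reference disc** `D(ζ) = tubeD_ref (ζ, 0, 0)` (Gompf's disc read through the reference tube). [folklore] -/
def discRef (ζ : ℂ) : (fishNu hε hε2).Surgered := (fishTref ε hε hε2).tubeD (ζ, 0, 0)

/-! ### The upper pieces at zero offset -/

/-- The `X^σ`-point with physical data `(N, Y, S)` at angle `ϑ`: `toSurg [(e^{i(N-ϑ)}, e^{iY}, e^{iϑ}), S]`. [folklore] -/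
def uPt (N Y ϑ S : ℝ) : (fishNu hε hε2).Surgered :=
  toSurg (fishNu hε hε2) (mtCoord tubeShearDiffeo (WithLp.toLp 2 ![N - ϑ, Y, ϑ], S))

/-- `physX hε hε2 (N, Y, ϑ, S) = uPt hε hε2 N Y ϑ S`. [folklore] -/
theorem physX_eq_uPt (N Y ϑ S : ℝ) : physX hε hε2 (N, Y, ϑ, S) = uPt hε hε2 N Y ϑ S := rfl

/-- `dchartX hε hε2 nj (P, Y, ϑ) = uPt hε hε2 (capN ε (capD0 ε nj + P)) Y ϑ (capS (capD0 ε nj + P))`. [folklore] -/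
theorem dchartX_eq_uPt (nj : ℝ) (P : ℂ) (Y ϑ : ℝ) :
    dchartX hε hε2 nj (P, Y, ϑ) = uPt hε hε2 (capN ε (capD0 ε nj + P)) Y ϑ (capS (capD0 ε nj + P)) := rfl

/-- **U1 at zero offset**: `(N, Y, S) = (n_j, y_h, 1 + h (posL r - L_c))`. [folklore] -/
theorem winU1_zero (ζ : ℂ) : (fishTref ε hε hε2).winU1 (ζ, 0, 0) =
    uPt hε hε2 (nj ε) cY (arg ζ) (1 + bxH * ((fishTref ε hε hε2).posL ‖ζ‖ - Lc ε)) := by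
  rw [TubeDData.winU1, radialForm_apply]
  show pieceU1 _ _ (nj ε) cY 1 (Lc ε) (fun _ ↦ 0) ((fishTref ε hε hε2).posL ‖ζ‖, arg ζ, (0:ℝ), (0:ℝ)) = _
  rw [pieceU1, legTubeMap_zero]
  show physX hε hε2 (nj ε + (rotAB (arg ζ) 0 0).2, cY - (rotAB (arg ζ) 0 0).1, arg ζ, 1 + bxH * ((fishTref ε hε hε2).posL ‖ζ‖ - Lc ε)) = _
  simp only [rotAB, zero_mul, add_zero, neg_zero, sub_zero]
  rfl

/-- **U2 at zero offset**: `(N, Y, S) = (n_j, y_h - Y₂, t₀ + X₂)`, `(X₂, Y₂) = pathShell R₀ (β, 0)`. [folklore] -/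
theorem winU2_zero (ζ : ℂ) : (fishTref ε hε hε2).winU2 (ζ, 0, 0) =
    uPt hε hε2 (nj ε) (cY - (pathShell R0 (angleDown (rone ε) ‖ζ‖, 0)).2) (arg ζ)
      (3 / 4 - 2 * R0 + (pathShell R0 (angleDown (rone ε) ‖ζ‖, 0)).1) := by
  rw [TubeDData.winU2, radialForm_apply]
  show pieceU2 _ _ (nj ε) R0 cY (3 / 4 - 2 * R0) (angleDown (rone ε) ‖ζ‖, arg ζ, (0:ℝ), (0:ℝ)) = _
  rw [pieceU2]
  simp only [pathTubeMap, rotAB, zero_mul, add_zero, neg_zero, sub_zero]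
  rfl

include hε in
/-- `vertCore y ℓ 0 = (n_j, 3/4)` (both blended chart maps vanish at `0`). [folklore] -/
theorem vertCore_zero (V : VertProfile) (y ℓ : ℝ) : vertCore ε (nj ε) V y ℓ 0 = (nj ε, 3 / 4) := by
  rw [vertCore, zero_mul, map_zero, capSwitchMap, map_zero, capPhi_zero hε (nj_sq_lt ε hε) (nj_neg ε hε)]
  simp

/-- **U3 at zero offset**: `(N, Y, S) = (n_j, yfun r, 3/4)`. [folklore] -/
theorem winU3_zero (ζ : ℂ) : (fishTref ε hε hε2).winU3 (ζ, 0, 0) =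
    uPt hε hε2 (nj ε) ((fishTref ε hε hε2).yfun ‖ζ‖) (arg ζ) (3 / 4) := by
  rw [TubeDData.winU3, radialForm_apply]
  show pieceU3 _ _ (nj ε) (vert ε hε hε2) ((fishTref ε hε hε2).yfun ‖ζ‖, arg ζ, lam ε * (0:ℝ), lam ε * (0:ℝ)) = _
  rw [pieceU3]
  have hε' : (fishTref ε hε hε2).ε = ε := rfl
  simp only [mul_zero, Complex.ofReal_zero, zero_mul, add_zero, hε', vertCore_zero hε]
  rfl

/-- **U4 at zero offset**: `(N, Y, S) = (capN d, y, capS d)`, `d = d₀ + uU y · e^{iϑ}`, `y = footY ρ_A α`. [folklore] -/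
theorem winU4_zero (ζ : ℂ) : (fishTref ε hε hε2).winU4 (ζ, 0, 0) =
    uPt hε hε2 (capN ε (capD0 ε (nj ε) + (uU ρA (footY ρA (angleUp (rzero ε) ‖ζ‖)) : ℂ) * exp (arg ζ * I)))
      (footY ρA (angleUp (rzero ε) ‖ζ‖)) (arg ζ)
      (capS (capD0 ε (nj ε) + (uU ρA (footY ρA (angleUp (rzero ε) ‖ζ‖)) : ℂ) * exp (arg ζ * I))) := by
  rw [TubeDData.winU4, radialForm_apply]
  show pieceU4 _ _ (nj ε) ρA (footY ρA (angleUp (rzero ε) ‖ζ‖), arg ζ, lam ε * (0:ℝ), lam ε * (0:ℝ)) = _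
  rw [pieceU4]
  simp only [tubeUpMap, tubeUp, mul_zero, add_zero, zero_mul, Complex.ofReal_zero, sub_zero]
  rfl

/-- **U5 at zero offset**: `(N, Y, S) = (capN d, Y₅, capS d)`, `d = d₀ + X₅ e^{iϑ}`, `(X₅, Y₅) = pathShell ρ_A (α, 0)`. [folklore] -/
theorem winU5_zero (ζ : ℂ) : (fishTref ε hε hε2).winU5 (ζ, 0, 0) =
    uPt hε hε2 (capN ε (capD0 ε (nj ε) + ((pathShell ρA (angleUp (rzero ε) ‖ζ‖, 0)).1 : ℂ) * exp (arg ζ * I)))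
      (pathShell ρA (angleUp (rzero ε) ‖ζ‖, 0)).2 (arg ζ)
      (capS (capD0 ε (nj ε) + ((pathShell ρA (angleUp (rzero ε) ‖ζ‖, 0)).1 : ℂ) * exp (arg ζ * I))) := by
  rw [TubeDData.winU5, radialForm_apply]
  show pieceU5 _ _ (nj ε) ρA (angleUp (rzero ε) ‖ζ‖, arg ζ, lam ε * (0:ℝ), lam ε * (0:ℝ)) = _
  rw [pieceU5]
  simp only [shellTubeMap, profTubeMap, profTube, mul_zero, sub_zero]
  rfl

/-! ### Zone maps at zero offset -/

/-- `√(n²) = |n|`: the sphere zone at zero offset. [folklore] -/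
theorem sphX_zero (n : ℝ) : sphX n 0 0 = |n| := by
  rw [sphX]; simp [Real.sqrt_sq_eq_abs]

/-- Invariants of the rescaling zone at zero offset, `n ≥ 0`. [folklore] -/
theorem inv_scaleReal_zero (kap : ℝ → ℝ) {n : ℝ} (hn : 0 ≤ n) (ϑ : ℝ) :
    latC (mtCoord tubeShearDiffeo (scaleReal kap (n, baseOf (exp (ϑ * I)), 0, 0))) = Circle.exp n ∧
      yC (mtCoord tubeShearDiffeo (scaleReal kap (n, baseOf (exp (ϑ * I)), 0, 0))) = 1 ∧
      baseC (mtCoord tubeShearDiffeo (scaleReal kap (n, baseOf (exp (ϑ * I)), 0, 0))) = Circle.exp ϑ := by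
  have h := invariants_mtCoord_baseOf (WithLp.toLp 2 ![sphX n (kap n * 0) (kap n * 0), kap n * 0, -(kap n * 0)]) ϑ
  rw [scaleReal]
  simp only [mul_zero, neg_zero] at h ⊢
  refine ⟨?_, by rw [h.2.1]; simp, h.2.2⟩
  rw [h.1]; simp [sphX_zero, abs_of_nonneg hn]

/-- Invariants of the switch zone at zero offset, `n ≥ 0`. [folklore] -/
theorem inv_switchXReal_zero (μ : ℝ → ℝ) (kap : ℝ) {n : ℝ} (hn : 0 ≤ n) (ϑ : ℝ) :
    latC (mtCoord tubeShearDiffeo (switchXReal μ kap (n, baseOf (exp (ϑ * I)), 0, 0))) = Circle.exp n ∧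
      yC (mtCoord tubeShearDiffeo (switchXReal μ kap (n, baseOf (exp (ϑ * I)), 0, 0))) = 1 ∧
      baseC (mtCoord tubeShearDiffeo (switchXReal μ kap (n, baseOf (exp (ϑ * I)), 0, 0))) = Circle.exp ϑ := by
  have h := invariants_mtCoord_baseOf (WithLp.toLp 2 ![switchX μ kap n 0 0, kap * 0, -(kap * 0)]) ϑ
  rw [switchXReal]
  simp only [mul_zero, neg_zero] at h ⊢
  refine ⟨?_, by rw [h.2.1]; simp, h.2.2⟩
  rw [h.1]
  have : switchX μ kap n 0 0 = n := by simp only [switchX, mul_zero, add_zero, sphX_zero, abs_of_nonneg hn]; ring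
  simp [this]

/-- Invariants of the north rescaling zone at zero offset (latitude `-n`, `n ≥ 0`). [folklore] -/
theorem inv_scaleRealN_zero (kap : ℝ → ℝ) {n : ℝ} (hn : 0 ≤ n) (ϑ : ℝ) :
    latC (mtCoord tubeShearDiffeo (scaleRealN kap (n, baseOf (exp (ϑ * I)), 0, 0))) = Circle.exp (-n) ∧
      yC (mtCoord tubeShearDiffeo (scaleRealN kap (n, baseOf (exp (ϑ * I)), 0, 0))) = 1 ∧
      baseC (mtCoord tubeShearDiffeo (scaleRealN kap (n, baseOf (exp (ϑ * I)), 0, 0))) = Circle.exp ϑ := by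
  have h := invariants_mtCoord_baseOf (WithLp.toLp 2 ![-sphX n (kap n * 0) (kap n * -0), kap n * 0, -(kap n * 0)]) ϑ
  rw [scaleRealN_apply]
  simp only [mul_zero, neg_zero] at h ⊢
  refine ⟨?_, by rw [h.2.1]; simp, h.2.2⟩
  rw [h.1]; simp [sphX_zero, abs_of_nonneg hn]

/-- Invariants of the north switch zone at zero offset. [folklore] -/
theorem inv_switchXRealN_zero (μ : ℝ → ℝ) (kap : ℝ) {n : ℝ} (hn : 0 ≤ n) (ϑ : ℝ) :
    latC (mtCoord tubeShearDiffeo (switchXRealN μ kap (n, baseOf (exp (ϑ * I)), 0, 0))) = Circle.exp (-n) ∧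
      yC (mtCoord tubeShearDiffeo (switchXRealN μ kap (n, baseOf (exp (ϑ * I)), 0, 0))) = 1 ∧
      baseC (mtCoord tubeShearDiffeo (switchXRealN μ kap (n, baseOf (exp (ϑ * I)), 0, 0))) = Circle.exp ϑ := by
  have hneg : switchXRealN μ kap (n, baseOf (exp (ϑ * I)), 0, 0) = mirrorL (switchXReal μ kap (n, baseOf (exp (ϑ * I)), 0, -0)) := rfl
  rw [hneg, neg_zero]
  have h := invariants_mtCoord_baseOf (WithLp.toLp 2 ![-switchX μ kap n 0 0, kap * 0, -(-(kap * 0))]) ϑ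
  rw [switchXReal, mirrorL_apply]
  simp only [mul_zero, neg_zero] at h ⊢
  have hv : (WithLp.toLp 2 ![-(WithLp.toLp 2 ![switchX μ kap n 0 0, (0:ℝ), 0]) 0, (WithLp.toLp 2 ![switchX μ kap n 0 0, (0:ℝ), 0]) 1,
      -(WithLp.toLp 2 ![switchX μ kap n 0 0, (0:ℝ), 0]) 2] : 𝔼 3) = WithLp.toLp 2 ![-switchX μ kap n 0 0, 0, 0] := by
    ext i; fin_cases i <;> simp
  rw [hv]
  refine ⟨?_, by rw [h.2.1]; simp, h.2.2⟩
  rw [h.1]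
  have : switchX μ kap n 0 0 = n := by simp only [switchX, mul_zero, add_zero, sphX_zero, abs_of_nonneg hn]; ring
  simp [this]

/-- Invariants of the flat-annulus zone at zero offset. [folklore] -/
theorem inv_midNS_zero (c δ lam n ϑ : ℝ) :
    latC (midNS δ lam c (n, baseOf (exp (ϑ * I)), 0, 0)) = Circle.exp n ∧
      yC (midNS δ lam c (n, baseOf (exp (ϑ * I)), 0, 0)) = 1 ∧
      baseC (midNS δ lam c (n, baseOf (exp (ϑ * I)), 0, 0)) = Circle.exp ϑ := by
  rw [midNS]
  show latC (mtPt tubeShearDiffeo (midT3 c δ lam n (baseOf (exp (ϑ * I))) 0 0) _) = _ ∧ _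
  rw [midT3]
  have h := invariants_mtPt_baseOf n (Circle.exp (lam * 0)) (Circle.exp (midEll c δ lam n (baseOf (exp (ϑ * I))) 0)) ϑ
  refine ⟨h.1, by rw [h.2.1, mul_zero, Circle.exp_zero], h.2.2⟩

include hε in
/-- Invariants of the north chart zone at zero offset, `d ≠ 0`. [folklore] -/
theorem inv_northNS_zero {tj δ r₁ r₂ r₃ : ℝ} (lam : ℝ) {d : ℂ} (hd : d ≠ 0) :
    latC (northNS ε tj δ r₁ r₂ r₃ lam tubeShearDiffeo (capN ε d, baseOf (exp (arg d * I)), 0, 0)) = Circle.exp (capN ε d) ∧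
      yC (northNS ε tj δ r₁ r₂ r₃ lam tubeShearDiffeo (capN ε d, baseOf (exp (arg d * I)), 0, 0)) = 1 ∧
      baseC (northNS ε tj δ r₁ r₂ r₃ lam tubeShearDiffeo (capN ε d, baseOf (exp (arg d * I)), 0, 0)) = Circle.exp (arg d) := by
  rw [northNS]
  show latC (mtPt tubeShearDiffeo (northT3 ε tj δ r₁ r₂ r₃ lam (capPt ε (capN ε d) (baseOf (exp (arg d * I)))) 0 0) (baseOf (exp (arg d * I)))) = _ ∧
    yC (mtPt tubeShearDiffeo (northT3 ε tj δ r₁ r₂ r₃ lam (capPt ε (capN ε d) (baseOf (exp (arg d * I)))) 0 0) (baseOf (exp (arg d * I)))) = _ ∧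
    baseC (mtPt tubeShearDiffeo (northT3 ε tj δ r₁ r₂ r₃ lam (capPt ε (capN ε d) (baseOf (exp (arg d * I)))) 0 0) (baseOf (exp (arg d * I)))) = _
  rw [baseOf_exp_arg hd, capPt_capN_baseOf hε, northT3]
  have h := invariants_mtPt_baseOf (capN ε d) (Circle.exp (lam * 0)) (northZ3 tj δ r₁ r₂ r₃ lam d 0) (arg d)
  rw [baseOf_exp_arg hd] at h
  refine ⟨h.1, by rw [h.2.1, mul_zero, Circle.exp_zero], h.2.2⟩

/-! ### Old points off the circle -/

/-- A point `[x, s]` with `latC ≠ 1`, `0 < s < 3/2`, lies off the surgery circle. [folklore] -/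
theorem mtPt_mem_complement_of_latC {x : ThreeTorus} {s : ℝ} (hs0 : 0 < s) (hs1 : s < 3 / 2)
    (h : latC (mtPt tubeShearDiffeo x s) ≠ 1) : mtPt tubeShearDiffeo x s ∈ (fishNu hε hε2).complement := by
  refine mtPt_mem_complement hε hε2 (fun hx ↦ h ?_) hs0 hs1
  rw [hx, latC_mtPt _ hs0 hs1]; simp

/-- `e^{in} ≠ 1` for `0 < |n| < 2π`. [folklore] -/
theorem circleExp_ne_one {n : ℝ} (h0 : n ≠ 0) (h1 : |n| < 2 * π) : Circle.exp n ≠ 1 :=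
  fun h ↦ h0 (eq_zero_of_circleExp_eq_one h h1)

/-- **An old point of `X^σ` with given invariants**: `p = toSurg m`, `m` off the circle,
`(latC, yC, baseC)(m) = (e^{iΛ}, e^{iY}, e^{iΘ})`. [folklore] -/
def OldPt (p : (fishNu hε hε2).Surgered) (Λ Y Θ : ℝ) : Prop :=
  ∃ m ∈ (fishNu hε hε2).complement, p = toSurg (fishNu hε hε2) m ∧ latC m = Circle.exp Λ ∧ yC m = Circle.exp Y ∧
    baseC m = Circle.exp Θ

variable {hε hε2} in
/-- Two old points are equal only if their invariants agree on the circle. [folklore] -/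
theorem OldPt.inv_eq {p : (fishNu hε hε2).Surgered} {Λ Y Θ Λ' Y' Θ' : ℝ} (h : OldPt hε hε2 p Λ Y Θ) (h' : OldPt hε hε2 p Λ' Y' Θ') :
    Circle.exp Λ = Circle.exp Λ' ∧ Circle.exp Y = Circle.exp Y' ∧ Circle.exp Θ = Circle.exp Θ' := by
  obtain ⟨m, hm, hp, h1, h2, h3⟩ := h
  obtain ⟨m', hm', hp', h1', h2', h3'⟩ := h'
  have hmm : m = m' := toSurg_inj hm hm' (hp.symm.trans hp')
  subst hmm
  exact ⟨h1.symm.trans h1', h2.symm.trans h2', h3.symm.trans h3'⟩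

/-- The physical point `uPt N Y ϑ S` (`0 < S < 3/2`, `N ∉ 2πℤ` small) is an old point with invariants
`(N, Y, 2πS)`. [folklore] -/
theorem oldPt_uPt {N Y ϑ S : ℝ} (hS0 : 0 < S) (hS1 : S < 3 / 2) (hN0 : N ≠ 0) (hN1 : |N| < 2 * π) :
    OldPt hε hε2 (uPt hε hε2 N Y ϑ S) N Y (2 * π * S) := by
  refine ⟨mtCoord tubeShearDiffeo (WithLp.toLp 2 ![N - ϑ, Y, ϑ], S), ?_, rfl, ?_, ?_, ?_⟩
  · refine mtPt_mem_complement_of_latC hε hε2 hS0 hS1 ?_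
    rw [← mtCoord, latC_mtCoord (q := (WithLp.toLp 2 ![N - ϑ, Y, ϑ], S)) hS0 hS1]
    simp only [show (WithLp.toLp 2 ![N - ϑ, Y, ϑ] : 𝔼 3) 0 + (WithLp.toLp 2 ![N - ϑ, Y, ϑ] : 𝔼 3) 2 = N by simp]
    exact circleExp_ne_one hN0 hN1
  · rw [latC_mtCoord (q := (WithLp.toLp 2 ![N - ϑ, Y, ϑ], S)) hS0 hS1]; congr 1; simp
  · rw [yC_mtCoord (q := (WithLp.toLp 2 ![N - ϑ, Y, ϑ], S)) hS0 hS1]; rfl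
  · exact baseC_mtCoord (q := (WithLp.toLp 2 ![N - ϑ, Y, ϑ], S)) hS0 hS1

/-! ### The south chart and the flat annulus at zero offset -/

include hε2 in
/-- **The south window at zero offset** (`0 < ‖ζ‖ < 1`): the rescaling zone's value. [folklore] -/
theorem winS_zero {ζ : ℂ} (h0 : ζ ≠ 0) (h1 : ‖ζ‖ < 1) :
    (fishTref ε hε hε2).winS (ζ, 0, 0) =
      toSurg (fishNu hε hε2) (mtCoord tubeShearDiffeo (scaleReal (kap ε) (-capN ε ζ, baseOf (exp (arg ζ * I)), 0, 0))) := by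
  rw [TubeDData.winS, tubeD0S]
  by_cases hr : ‖ζ‖ < 1 / 2
  · rw [glueBy_of_lt (τ := fun q : ℂ × ℝ × ℝ ↦ ‖q.1‖) hr]
    show pieceS1 hε hε2 1 (ζ, 0, 0) = _
    rw [pieceS1_eq_pieceS2 hε hε2 (kapS := kap ε) h0 h1 (by norm_num)
      (by rw [one_mul]; exact kap_of_le hε (neg_capN_lt_of_norm_lt hε (by show ‖ζ‖ < 53 / 100; linarith)).le)]
    rfl
  · rw [glueBy_of_le (τ := fun q : ℂ × ℝ × ℝ ↦ ‖q.1‖) (not_lt.1 hr)]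
    rfl

include hε2 in
/-- The south window at zero offset is an old point with invariants `(nfun r, 0, ϑ)`. [folklore] -/
theorem oldPt_winS {ζ : ℂ} (h0 : ζ ≠ 0) (h1 : ‖ζ‖ < 1) :
    OldPt hε hε2 ((fishTref ε hε hε2).winS (ζ, 0, 0)) ((fishTref ε hε hε2).nfun ‖ζ‖) 0 (arg ζ) := by
  rw [winS_zero hε hε2 h0 h1]
  have hn0 : 0 ≤ -capN ε ζ := (neg_capN_pos hε h0).le
  obtain ⟨hl, hy, hb⟩ := inv_scaleReal_zero (kap ε) hn0 (arg ζ)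
  have hb' := baseOf_mem' (exp (arg ζ * I))
  have hnfun : (fishTref ε hε hε2).nfun ‖ζ‖ = -capN ε ζ := by
    rw [fishTref_eq, nfun_of_le hε hε2 (by linarith), latF_of_le h1.le, southLat, capN]
  refine ⟨_, ?_, rfl, by rw [hl, hnfun], by rw [hy, Circle.exp_zero], hb⟩
  rw [scaleReal]
  refine mtPt_mem_complement_of_latC hε hε2 hb'.1 hb'.2 ?_
  rw [← mtCoord, ← scaleReal, hl]
  exact circleExp_ne_one (by linarith [neg_capN_pos hε h0]) (by
    rw [abs_of_nonneg hn0]; linarith [neg_capN_lt_eps hε ζ, Real.pi_gt_three, hε2])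

include hε2 in
/-- **The flat-annulus window at zero offset** is an old point with invariants `(nfun r, 0, ϑ)`
(`0 < nfun r < 2π`). [folklore] -/
theorem oldPt_winA {ζ : ℂ} (hn0 : 0 < (fishTref ε hε hε2).nfun ‖ζ‖) (hn1 : (fishTref ε hε hε2).nfun ‖ζ‖ < 2 * π) :
    OldPt hε hε2 ((fishTref ε hε hε2).winA (ζ, 0, 0)) ((fishTref ε hε hε2).nfun ‖ζ‖) 0 (arg ζ) := by
  set T := fishTref ε hε hε2 with hT
  set n := T.nfun ‖ζ‖ with hn
  have hb' := baseOf_mem' (exp (arg ζ * I))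
  have hne : Circle.exp n ≠ 1 := circleExp_ne_one hn0.ne' (by rw [abs_of_pos hn0]; exact hn1)
  rw [TubeDData.winA, radialForm_apply, tubeD0A]
  change OldPt hε hε2 (glue2 T.nA (pieceA2 T.hε T.hε2 T.kapS) (glue2 T.nB (pieceA3 T.hε T.hε2 T.lam T.μS) (pieceAM T.hε T.hε2 T.δ T.lam T.cut))
    (n, arg ζ, (0:ℝ), (0:ℝ))) n 0 (arg ζ)
  by_cases hA : n < T.nA
  · rw [glue2_of_lt hA, pieceA2, zoneS2_apply]
    change OldPt hε hε2 (toSurg _ (mtCoord tubeShearDiffeo (scaleReal (kap ε) (n, baseOf (exp (arg ζ * I)), 0, 0)))) n 0 (arg ζ)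
    obtain ⟨hl, hy, hb⟩ := inv_scaleReal_zero (kap ε) hn0.le (arg ζ)
    refine ⟨_, ?_, rfl, hl, by rw [hy, Circle.exp_zero], hb⟩
    rw [scaleReal]
    refine mtPt_mem_complement_of_latC hε hε2 hb'.1 hb'.2 ?_
    rw [← mtCoord, ← scaleReal, hl]; exact hne
  rw [glue2_of_le (not_lt.1 hA)]
  by_cases hB : n < T.nB
  · rw [glue2_of_lt hB, pieceA3, zoneS3_apply]
    change OldPt hε hε2 (toSurg _ (mtCoord tubeShearDiffeo (switchXReal (muS ε) (lam ε) (n, baseOf (exp (arg ζ * I)), 0, 0)))) n 0 (arg ζ)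
    obtain ⟨hl, hy, hb⟩ := inv_switchXReal_zero (muS ε) (lam ε) hn0.le (arg ζ)
    refine ⟨_, ?_, rfl, hl, by rw [hy, Circle.exp_zero], hb⟩
    rw [switchXReal]
    refine mtPt_mem_complement_of_latC hε hε2 hb'.1 hb'.2 ?_
    rw [← mtCoord, ← switchXReal, hl]; exact hne
  · rw [glue2_of_le (not_lt.1 hB), pieceAM, zoneM]
    change OldPt hε hε2 (toSurg (fishNu hε hε2) (midNS T.δ T.lam T.cut (n, baseOf (exp (arg ζ * I)), (0:ℝ), (0:ℝ)))) n 0 (arg ζ)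
    obtain ⟨hl, hy, hb⟩ := inv_midNS_zero T.cut T.δ T.lam n (arg ζ)
    refine ⟨_, ?_, rfl, hl, by rw [hy, Circle.exp_zero], hb⟩
    rw [midNS]
    exact mtPt_mem_complement_of_latC hε hε2 hb'.1 hb'.2 (by rw [← midNS, hl]; exact hne)

/-! ### The north chart at zero offset -/

/-- The translated chart coordinate of the reference disc at `ζ`: `d = tdisc (P(‖ζ‖) e^{i arg ζ})`. [folklore] -/
def dN (ζ : ℂ) : ℂ := (fishTref ε hε hε2).tdisc (((fishTref ε hε hε2).Pfun ‖ζ‖ : ℂ) * exp (arg ζ * I))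

/-- The north window of the reference tube on the zero section. [folklore] -/
theorem winN_zero (ζ : ℂ) : (fishTref ε hε hε2).winN (ζ, 0, 0) =
    tubeD0N hε hε2 (capTj ε (nj ε)) (1 / 200) (1 / 5) (1 / 4) (3 / 10) (lam ε) 1 (kap ε) (muN ε) (nj ε)
      (capTj ε (nj ε) + 3 / 10) (dN hε hε2 ζ, 0, 0) := rfl

include hε2 in
/-- **The north window at zero offset, off the chart centre**, is an old point with invariants
`(capN d, 0, arg d)`. [folklore] -/
theorem oldPt_winN {ζ : ℂ} (hd : dN hε hε2 ζ ≠ 0) :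
    OldPt hε hε2 ((fishTref ε hε hε2).winN (ζ, 0, 0)) (capN ε (dN hε hε2 ζ)) 0 (arg (dN hε hε2 ζ)) := by
  set d := dN hε hε2 ζ with hdd
  have hb' := baseOf_mem' (exp (arg d * I))
  have hn0 : 0 < -capN ε d := neg_capN_pos hε hd
  have hne : Circle.exp (capN ε d) ≠ 1 := circleExp_ne_one (by linarith) (by
    rw [abs_of_neg (by linarith)]; linarith [neg_capN_lt_eps hε d, Real.pi_gt_three, hε2])
  rw [winN_zero, tubeD0N]
  by_cases h1 : ‖d‖ < 1 / 2
  · rw [glueBy_of_lt (τ := fun q : ℂ × ℝ × ℝ ↦ ‖q.1‖) h1]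
    change OldPt hε hε2 (pieceN1 hε hε2 1 (d, (0:ℝ), (0:ℝ))) _ _ _
    rw [pieceN1_eq_pieceN2 hε hε2 (kapN := kap ε) hd (by linarith) (by norm_num)
      (by rw [one_mul]; exact kap_of_le hε (neg_capN_lt_of_norm_lt hε (by show ‖d‖ < 53 / 100; linarith)).le),
      pieceN2, polarForm_apply, zoneN2_apply]
    obtain ⟨hl, hy, hb⟩ := inv_scaleRealN_zero (kap ε) hn0.le (arg d)
    rw [neg_neg] at hl
    refine ⟨_, ?_, rfl, hl, by rw [hy, Circle.exp_zero], hb⟩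
    rw [scaleRealN_apply] at hl ⊢
    exact mtPt_mem_complement_of_latC hε hε2 hb'.1 hb'.2 (by rw [← mtCoord, hl]; exact hne)
  rw [glueBy_of_le (τ := fun q : ℂ × ℝ × ℝ ↦ ‖q.1‖) (not_lt.1 h1)]
  by_cases h2 : ‖d‖ < 13 / 20
  · rw [glueBy_of_lt (τ := fun q : ℂ × ℝ × ℝ ↦ ‖q.1‖) h2, pieceN2, polarForm_apply, zoneN2_apply]
    obtain ⟨hl, hy, hb⟩ := inv_scaleRealN_zero (kap ε) hn0.le (arg d)
    rw [neg_neg] at hl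
    refine ⟨_, ?_, rfl, hl, by rw [hy, Circle.exp_zero], hb⟩
    rw [scaleRealN_apply] at hl ⊢
    exact mtPt_mem_complement_of_latC hε hε2 hb'.1 hb'.2 (by rw [← mtCoord, hl]; exact hne)
  rw [glueBy_of_le (τ := fun q : ℂ × ℝ × ℝ ↦ ‖q.1‖) (not_lt.1 h2)]
  by_cases h3 : ‖d‖ < 4 / 5
  · rw [glueBy_of_lt (τ := fun q : ℂ × ℝ × ℝ ↦ ‖q.1‖) h3, pieceN3, polarForm_apply, zoneN3_apply]
    obtain ⟨hl, hy, hb⟩ := inv_switchXRealN_zero (muN ε) (lam ε) hn0.le (arg d)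
    rw [neg_neg] at hl
    refine ⟨_, ?_, rfl, hl, by rw [hy, Circle.exp_zero], hb⟩
    have hform : switchXRealN (muN ε) (lam ε) (-capN ε d, baseOf (exp (arg d * I)), 0, 0) =
        mirrorL (switchXReal (muN ε) (lam ε) (-capN ε d, baseOf (exp (arg d * I)), 0, -0)) := rfl
    rw [hform, switchXReal, mirrorL_apply] at hl ⊢
    exact mtPt_mem_complement_of_latC hε hε2 hb'.1 hb'.2 (by rw [← mtCoord, hl]; exact hne)
  rw [glueBy_of_le (τ := fun q : ℂ × ℝ × ℝ ↦ ‖q.1‖) (not_lt.1 h3)]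
  by_cases h4 : ‖d‖ < capTj ε (nj ε) + 3 / 10
  · rw [glueBy_of_lt (τ := fun q : ℂ × ℝ × ℝ ↦ ‖q.1‖) h4, pieceN4, polarForm_apply, zoneN4]
    change OldPt hε hε2 (toSurg (fishNu hε hε2) (northNS ε (capTj ε (nj ε)) (1 / 200) (1 / 5) (1 / 4) (3 / 10) (lam ε) tubeShearDiffeo
      (capN ε d, baseOf (exp (arg d * I)), (0:ℝ), (0:ℝ)))) _ _ _
    obtain ⟨hl, hy, hb⟩ := inv_northNS_zero hε (tj := capTj ε (nj ε)) (δ := 1 / 200) (r₁ := 1 / 5) (r₂ := 1 / 4) (r₃ := 3 / 10) (lam := lam ε) hd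
    refine ⟨_, ?_, rfl, hl, by rw [hy, Circle.exp_zero], hb⟩
    rw [northNS] at hl ⊢
    exact mtPt_mem_complement_of_latC hε hε2 hb'.1 hb'.2 (by rw [hl]; exact hne)
  · rw [glueBy_of_le (τ := fun q : ℂ × ℝ × ℝ ↦ ‖q.1‖) (not_lt.1 h4), pieceM, polarForm_apply, zoneM]
    change OldPt hε hε2 (toSurg (fishNu hε hε2) (midNS (1 / 200) (lam ε) (nj ε) (capN ε d, baseOf (exp (arg d * I)), (0:ℝ), (0:ℝ)))) _ _ _
    obtain ⟨hl, hy, hb⟩ := inv_midNS_zero (nj ε) (1 / 200) (lam ε) (capN ε d) (arg d)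
    refine ⟨_, ?_, rfl, hl, by rw [hy, Circle.exp_zero], hb⟩
    rw [midNS] at hl ⊢
    exact mtPt_mem_complement_of_latC hε hε2 hb'.1 hb'.2 (by rw [hl]; exact hne)

/-- **The north window at zero offset at the chart centre** is the new point `capEndN (0, 0, 0)`. [folklore] -/
theorem winN_zero_centre {ζ : ℂ} (hd : dN hε hε2 ζ = 0) :
    (fishTref ε hε hε2).winN (ζ, 0, 0) = capEndN (fishNu hε hε2) 1 (0, 0, 0) := by
  rw [winN_zero, tubeD0N, glueBy_of_lt (τ := fun q : ℂ × ℝ × ℝ ↦ ‖q.1‖) (by show ‖dN hε hε2 ζ‖ < 1 / 2; rw [hd, norm_zero]; norm_num),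
    hd]
  rfl

/-- **The south window at the disc centre** is the new point `capEnd (0, 0, 0)`. [folklore] -/
theorem winS_zero_centre : (fishTref ε hε hε2).winS (0, 0, 0) = capEnd (fishNu hε hε2) 1 (0, 0, 0) := by
  rw [TubeDData.winS, tubeD0S, glueBy_of_lt (τ := fun q : ℂ × ℝ × ℝ ↦ ‖q.1‖) (by show ‖(0:ℂ)‖ < 1 / 2; rw [norm_zero]; norm_num)]
  rfl

end FP

end Literature.Topology.FourManifolds
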